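import Summits.ResolutionOfSingularities.ResolutionOfSingularities.Theorems.MarkedTransferCampaignW13BypassRFlatFailure
import HarnessLib

/-!
# [OURS · L1 W1.3] The POSITIVE side of the rung-1 failure locus at `p = 2`, `e = 1`: AFFINE PARITY of the knock-out ⇒ POS
# (Diff-form), for every head and every tail (seat res-L1-s13-pv-1, g2)

LADDER-RESOLUTION rung L (rescue), cell `res-hironaka`, RESCUE-SEED slot W1.3 (architecture bypass, reading R-flat), F7′ row 1.
After the NEGATIVE side (p501051 Narasimhan, p503083 surface `u² + (x₁+x₂)³ + x₁⁵x₂`, p503641 coordinate dependence), this file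
banks the complementary POSITIVE class at `p = 2`, `q = 2` in closed form, for an ARBITRARY polynomial `g` and an ARBITRARY
candidate tail `τ` in `K[x_σ]` (`σ` finite, `K` any commutative ring of characteristic `2`):

**Affine-parity criterion** (`tail_sq_mem_pAlgPiece_of_affineParity`). If there is a weight `w : σ → ℕ` such that every monomial
`x^m` of the knock-out `T = g − τ²` has ODD weighted degree `Σ_i w_i m_i` — i.e. the parity vectors `m mod 2` of `supp T` lie on
an affine hyperplane `w·μ = 1` of `𝔽₂^σ` — then `τ² ∈ Diff^{(1)}((g)) ⊆ ℘_alg(((g),2),1)` (bound algebraic `℘`, row 003 U17_2;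
tree `Campaign.pAlgPiece`), with NO integral closure needed. PROOF: weighted Euler in characteristic `2`,
`Σ_i w_i·x_i·∂_i T = T` (`euler_of_affineParity`, each monomial returns with the odd factor `Σ w_i m_i = 1`), and
`∂_i T = ∂_i g` because `∂_i(τ²) = 2τ∂_iτ = 0`; so `T ∈ 𝔪·Diff^{(1)}((g))` and `τ² = g − T`.

It covers the slot's positive specimens uniformly: A (`x⁵`, `w = (1,·)`), D (`x₁x₂³`, `w = (1,0,·)`), the canonical chain of N
(`x₁x₂⁵`), B/C, and every head whose cleaned `ε` has only odd-degree monomials (`w ≡ 1`); and it is violated — for EVERY `w` —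
by both NEG witnesses: the surface `(x₁+x₂)³ + x₁⁵x₂` has parity vectors `(1,0), (0,1), (1,1)` (no affine hyperplane of `𝔽₂²`
missing `0` contains all three), Narasimhan's `yz³ + zw³ + y⁷w` has `(1,1,0), (0,1,1), (1,0,1)` (sum of the three conditions
gives `0 = 1`). So at `p = 2`, `e = 1` the dividing line found by this seat reads: affine parity ⇒ POS in Diff-form (this file);
no affine parity ⇒ POS can fail even at an isolated surface singularity (p503083), and does fail whenever an arc on the
hypersurface out-contacts all first partials (p501051 §1, the valuative criterion); in between (no affine parity, but POS by
the integral closure or by units, e.g. `x₁x₂ + x₁³ + x₂³` locally) lies the residual census territory.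

HONEST FRAMING. Nothing here is a statement of H. Hironaka's manuscript [Hironaka2017] (2017-03-23, lit key
`paper:url-3343fd9e678b`); OURS statements about the OURS bypass objects (reading R-flat, `℘` bound algebraic; candidate U17_4 not
used). Caveat of record: nothing here bears on L-G4 / (127) (`KangarooShadeIncrease`). AI bookkeeping weaker than expert review;
nothing here is progress on resolution of singularities in positive characteristic. All decls `[folklore]`, sorry-free.
-/

noncomputable section

set_option linter.dupNamespace false -- mandated namespace of this single-conjunct summit

namespace Summit.ResolutionOfSingularities.ResolutionOfSingularities.Theorems.Campaign.W13

open MvPolynomial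
open Literature.AlgebraicGeometry.Resolution
open Literature.AlgebraicGeometry.Hironaka2017
open Literature.AlgebraicGeometry.Hironaka2017.S09LLUED (LLChainData)

universe u

section AffineParity

variable (K : Type u) [CommRing K] [CharP K 2] {σ : Type} [Fintype σ]

/-- **Weighted Euler identity in characteristic 2, affine-parity form.** If every monomial `x^m` of `T` has odd weighted
degree `Σ_i w_i m_i`, then `Σ_i w_i·(x_i ∂_i T) = T` (Mathlib `X_mul_pderiv_monomial`: `x_i ∂_i x^m = m_i x^m`; an odd
natural number acts as `1` in characteristic `2`). [folklore] -/
theorem euler_of_affineParity (w : σ → ℕ) (T : MvPolynomial σ K)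
    (hT : ∀ m ∈ T.support, Odd (∑ i, w i * m i)) :
    ∑ i, w i • (X i * pderiv i T) = T := by
  have key : ∀ m ∈ T.support,
      ∑ i, w i • (X i * pderiv i (monomial m (coeff m T))) = monomial m (coeff m T) := by
    intro m hm
    simp_rw [X_mul_pderiv_monomial, smul_smul, ← Finset.sum_smul]
    rw [nsmul_eq_mul, CharTwo.natCast_eq_ite, if_neg (Nat.not_even_iff_odd.mpr (hT m hm)), one_mul]
  calc ∑ i, w i • (X i * pderiv i T)
      = ∑ i, w i • (X i * pderiv i (∑ m ∈ T.support, monomial m (coeff m T))) := by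
        rw [support_sum_monomial_coeff]
    _ = ∑ i, ∑ m ∈ T.support, w i • (X i * pderiv i (monomial m (coeff m T))) := by
        refine Finset.sum_congr rfl fun i _ => ?_
        rw [map_sum, Finset.mul_sum, Finset.smul_sum]
    _ = ∑ m ∈ T.support, ∑ i, w i • (X i * pderiv i (monomial m (coeff m T))) := Finset.sum_comm
    _ = ∑ m ∈ T.support, monomial m (coeff m T) := Finset.sum_congr rfl key
    _ = T := support_sum_monomial_coeff T

omit [Fintype σ] in
/-- In characteristic `2` squares are `∂`-constants: `∂_i(τ²) = 0`, so the knock-out `g − τ²` has the same first partials as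
`g`. [folklore] -/
theorem pderiv_sub_sq (i : σ) (g τ : MvPolynomial σ K) : pderiv i (g - τ ^ 2) = pderiv i g := by
  have h2 : (2 : MvPolynomial σ K) = 0 := CharTwo.two_eq_zero
  rw [map_sub, sub_eq_self, pderiv_pow]
  push_cast
  linear_combination (τ ^ 1 * pderiv i τ) * h2

/-- Under affine parity the knock-out is a value of order-`≤ 1` operators on `(g)`:
`g − τ² = Σ_i w_i x_i ∂_i g ∈ Diff^{(1)}((g))` (tree `Resolution.diffIdeal K 1`). [folklore] -/
theorem sub_sq_mem_diffIdeal_one_of_affineParity (g τ : MvPolynomial σ K) (w : σ → ℕ)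
    (hpar : ∀ m ∈ (g - τ ^ 2).support, Odd (∑ i, w i * m i)) :
    g - τ ^ 2 ∈ diffIdeal K 1 (Ideal.span {g}) := by
  rw [← euler_of_affineParity K w (g - τ ^ 2) hpar]
  refine Ideal.sum_mem _ fun i _ => ?_
  rw [pderiv_sub_sq]
  exact Submodule.smul_of_tower_mem _ (w i) (mul_pderiv_mem_diffIdeal K i (X i) g le_rfl)

/-- **AFFINE-PARITY CRITERION (POS, Diff-form), `p = 2`, `q = 2`.** For any `g`, `τ ∈ K[x_σ]` (`char K = 2`): if some weight
`w` gives every monomial of `g − τ²` odd weighted degree, then `τ² ∈ ℘_alg(((g),2),1)` — indeed `τ² = g − (g − τ²) ∈ (g) +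
Diff^{(1)}((g)) = Diff^{(1)}((g)) ⊆ ℘(Ě,1)` by p475548 `diffIdeal_le_pAlgPiece_one`. No canonical-class hypothesis, no integral
closure. [folklore] -/
theorem tail_sq_mem_pAlgPiece_of_affineParity (g τ : MvPolynomial σ K) (w : σ → ℕ)
    (hpar : ∀ m ∈ (g - τ ^ 2).support, Odd (∑ i, w i * m i)) :
    τ ^ 2 ∈ Campaign.pAlgPiece K (Ideal.span {g}) 2 1 := by
  have h : τ ^ 2 = g - (g - τ ^ 2) := by ring
  rw [h]
  refine diffIdeal_le_pAlgPiece_one K _ (by norm_num) (show 1 < 2 by norm_num) ?_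
  exact Ideal.sub_mem _ (le_diffIdeal K 1 _ (Ideal.subset_span rfl))
    (sub_sq_mem_diffIdeal_one_of_affineParity K g τ w hpar)

/-- The same in the v4 schema: every chain datum `d` with `e = 1` whose total knock-out `g(0) − tail²` has affine parity
satisfies `RFlatTailPow 2 K ((g(0)),2) d`. Covers A (`w = 1`), D / N-canonical (`w = (1,0,0)`), and every head whose cleaned
`ε − r²` has only odd-degree monomials; both NEG witnesses of p501051 / p503083 admit no such `w`. [folklore] -/
theorem rFlatTailPow_of_affineParity (d : LLChainData (MvPolynomial σ K)) (hde : d.e = 1) (w : σ → ℕ)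
    (hpar : ∀ m ∈ (d.g 0 - d.tail ^ 2).support, Odd (∑ i, w i * m i)) :
    Campaign.RFlatTailPow 2 K (Ideal.span {d.g 0}) (2 ^ d.e) d := by
  rw [Campaign.RFlatTailPow, hde, pow_one]
  exact tail_sq_mem_pAlgPiece_of_affineParity K (d.g 0) d.tail w hpar

/-- Unweighted special case (`w ≡ 1`): if every monomial of the knock-out `g − τ²` has ODD TOTAL DEGREE, then
`τ² ∈ ℘_alg(((g),2),1)`. [folklore] -/
theorem tail_sq_mem_pAlgPiece_of_odd_degree (g τ : MvPolynomial σ K)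
    (hodd : ∀ m ∈ (g - τ ^ 2).support, Odd (∑ i, m i)) :
    τ ^ 2 ∈ Campaign.pAlgPiece K (Ideal.span {g}) 2 1 :=
  tail_sq_mem_pAlgPiece_of_affineParity K g τ (fun _ => 1) (by simpa using hodd)

end AffineParity

/-! ## The specimens again, through the criterion -/

section Specimens

variable (K : Type) [Field K] [CharP K 2]

/-- Example D re-derived (`p = 2`, `K[x₁,x₂,y]`, head `y² + x₁x₂³`, tail `y`): the knock-out `x₁x₂³` has parity vector
`(1,1,0)`, on the affine hyperplane `w = (1,0,0)`; so `y² ∈ ℘_alg(Ě,1)` by the criterion (p479454 proved it by hand).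
[folklore] -/
theorem D_tail_sq_mem_of_affineParity :
    (X 2 : MvPolynomial (Fin 3) K) ^ 2 ∈
      Campaign.pAlgPiece K (Ideal.span {(X 2 ^ 2 + X 0 * X 1 ^ 3 : MvPolynomial (Fin 3) K)}) 2 1 := by
  refine tail_sq_mem_pAlgPiece_of_affineParity K _ _ ![1, 0, 0] ?_
  intro m hm
  rw [add_sub_cancel_left, X, X_pow_eq_monomial, monomial_mul] at hm
  rw [Finset.mem_singleton.mp (support_monomial_subset hm)]
  simp [Fin.sum_univ_three, Finsupp.single_apply]

end Specimens

end Summit.ResolutionOfSingularities.ResolutionOfSingularities.Theorems.Campaign.W13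

end
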